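import Literature.Probability.RandomPlanarGeometry.HullUniformizer
import HarnessLib

/-!
# Outer squeezes, part 2: the reflected defect in the half-plane model and its symmetric charts

Support file (`--supports stmt-CriticalPhenomena-0773`, towards the registered stub `stub_squeezeFamily`) of
the line `birth` for the crux `RestrictionOfLimit`. Pure plane topology / conformal mapping, no probability.

Model situation: a closed set `Kb ⊆ ℍ̄ = {im ≥ 0}` (it will be the pull-back of `cl D'` under a closed
half-plane chart of `cl D ∖ {b}`), connected, unbounded, with a real point. The **reflected defect** is the
open conjugation-symmetric set `Â = {z | foldH z ∉ Kb}` (`hat Kb`, `foldH (x + iy) = x + i|y|`), i.e.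
`(ℍ̄ ∖ Kb) ∪ conj (ℍ ∖ Kb)`. Its complement `Kb ∪ conj Kb` is closed, connected and unbounded, so every
connected component `comp Kb x` of `Â` is a simply connected proper subdomain of `ℂ`
(`Complex.isSimplyConnected_of_compl`, Conway VIII.2.2), symmetric under conjugation when `x` is real.
By the Riemann mapping theorem with uniqueness (tree: `exists_conformalEquiv_ball_deriv_pos`,
`ConformalEquiv.eqOn_of_deriv_pos`) the Riemann map normalised at the real point `x` commutes with `conj`
(`exists_conformalEquiv_map_conj`), hence maps the real trace onto the real diameter and the upper part
`comp Kb x ∩ ℍ` onto one open half-disc; composing with `w ↦ -w` if necessary we obtain a **symmetric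
chart** (`SymChart`): a homeomorphism of the component onto the unit disc commuting with `conj` and
sending `ℍ` to the upper half-disc (`nonempty_symChart`). Part 3 builds the bites from these charts.

References: L. V. Ahlfors, *Complex Analysis* (1979), Ch. 6 §1.1 (Riemann mapping, uniqueness);
J. B. Conway, *Functions of One Complex Variable I* (1978), Thm VIII.2.2. Axioms `propext`,
`Classical.choice`, `Quot.sound`.
-/

noncomputable section

open Set Filter Topology Metric Complex Bornology
open scoped ComplexConjugate
open Literature.Probability.RandomPlanarGeometry

namespace Summit.CriticalPhenomena.SAWScalingLimit.Theorems.RestrictionOfLimit.Birth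

/-! ### Folding the plane onto the closed upper half-plane -/

/-- `foldH (x + iy) = x + i|y|`: the plane folded onto `ℍ̄` along the real axis. [folklore] -/
def foldH (z : ℂ) : ℂ := ⟨z.re, |z.im|⟩

/-- `foldH` is continuous. [folklore] -/
theorem continuous_foldH : Continuous foldH := by
  have h : foldH = fun z : ℂ ↦ ((z.re : ℝ) : ℂ) + ((|z.im| : ℝ) : ℂ) * I := by
    funext z
    apply Complex.ext <;> simp [foldH]
  rw [h]
  fun_prop

/-- `foldH` fixes the closed upper half-plane. [folklore] -/
theorem foldH_of_im_nonneg {z : ℂ} (hz : 0 ≤ z.im) : foldH z = z :=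
  Complex.ext rfl (abs_of_nonneg hz)

/-- `foldH` is invariant under conjugation. [folklore] -/
theorem foldH_conj (z : ℂ) : foldH (conj z) = foldH z := by
  apply Complex.ext <;> simp [foldH]

/-- `foldH` takes values in `ℍ̄`. [folklore] -/
theorem foldH_im_nonneg (z : ℂ) : 0 ≤ (foldH z).im := abs_nonneg z.im

/-- Below the real axis `foldH` is conjugation. [folklore] -/
theorem foldH_of_im_neg {z : ℂ} (hz : z.im < 0) : foldH z = conj z :=
  Complex.ext (by simp [foldH]) (by simp [foldH, abs_of_neg hz])

/-! ### The reflected defect and its components -/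

/-- The **reflected defect** `Â = {z | foldH z ∉ Kb} = (ℍ̄ ∖ Kb) ∪ conj (ℍ ∖ Kb)`. [folklore] -/
def hat (Kb : Set ℂ) : Set ℂ := {z | foldH z ∉ Kb}

variable {Kb : Set ℂ}

/-- `Â` is open when `Kb` is closed. [folklore] -/
theorem isOpen_hat (hK : IsClosed Kb) : IsOpen (hat Kb) :=
  (continuous_foldH.isOpen_preimage _ hK.isOpen_compl)

/-- `Â` is symmetric under conjugation. [folklore] -/
theorem conj_mem_hat_iff {z : ℂ} : conj z ∈ hat Kb ↔ z ∈ hat Kb := by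
  simp only [hat, mem_setOf_eq, foldH_conj]

/-- On `ℍ̄`, `Â` is the complement of `Kb`. [folklore] -/
theorem mem_hat_iff_of_im_nonneg {z : ℂ} (hz : 0 ≤ z.im) : z ∈ hat Kb ↔ z ∉ Kb := by
  simp only [hat, mem_setOf_eq, foldH_of_im_nonneg hz]

/-- The complement of `Â` is `Kb ∪ conj Kb` (for `Kb ⊆ ℍ̄`). [folklore] -/
theorem compl_hat_eq (hKH : Kb ⊆ {z | 0 ≤ z.im}) : (hat Kb)ᶜ = Kb ∪ conj '' Kb := by
  ext z
  simp only [mem_compl_iff, hat, mem_setOf_eq, not_not, mem_union, mem_image]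
  constructor
  · intro hz
    rcases le_or_gt 0 z.im with h | h
    · left; rwa [foldH_of_im_nonneg h] at hz
    · right; exact ⟨conj z, by rwa [foldH_of_im_neg h] at hz, conj_conj z⟩
  · rintro (hz | ⟨w, hw, rfl⟩)
    · rwa [foldH_of_im_nonneg (hKH hz)]
    · rwa [foldH_conj, foldH_of_im_nonneg (hKH hw)]

/-- The complement of `Â` is connected (when `Kb ⊆ ℍ̄` is connected with a real point). [folklore] -/
theorem isPreconnected_compl_hat (hKH : Kb ⊆ {z | 0 ≤ z.im}) (hKc : IsPreconnected Kb)
    (hreal : ∃ x : ℝ, (x : ℂ) ∈ Kb) : IsPreconnected (hat Kb)ᶜ := by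
  obtain ⟨x, hx⟩ := hreal
  rw [compl_hat_eq hKH]
  refine IsPreconnected.union (x : ℂ) hx ⟨x, hx, Complex.conj_ofReal x⟩ hKc ?_
  exact hKc.image _ (Complex.continuous_conj.continuousOn)

/-- The component of `Â` containing the real point `x`. [folklore] -/
def comp (Kb : Set ℂ) (x : ℝ) : Set ℂ := connectedComponentIn (hat Kb) x

/-- Components of `Â` are open. [folklore] -/
theorem isOpen_comp (hK : IsClosed Kb) (x : ℝ) : IsOpen (comp Kb x) :=
  (isOpen_hat hK).connectedComponentIn

/-- `comp Kb x ⊆ Â`. [folklore] -/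
theorem comp_subset (x : ℝ) : comp Kb x ⊆ hat Kb := connectedComponentIn_subset _ _

/-- Components of `Â` through real points are symmetric under conjugation. [folklore] -/
theorem conj_mem_comp {x : ℝ} {z : ℂ} (hz : z ∈ comp Kb x) : conj z ∈ comp Kb x := by
  have hx : (x : ℂ) ∈ hat Kb := by
    by_contra h
    rw [comp, connectedComponentIn_eq_empty h] at hz
    exact hz
  have hsub : conj '' comp Kb x ⊆ comp Kb x := by
    refine (isPreconnected_connectedComponentIn.image _
      Complex.continuous_conj.continuousOn).subset_connectedComponentIn ?_ ?_
    · exact ⟨x, mem_connectedComponentIn hx, Complex.conj_ofReal x⟩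
    · rintro _ ⟨w, hw, rfl⟩
      exact conj_mem_hat_iff.2 (comp_subset x hw)
  exact hsub ⟨z, hz, rfl⟩

/-- The frontier of a component of the open set `Â` misses `Â`. [folklore] -/
theorem frontier_connectedComponentIn_subset_compl (hK : IsClosed Kb) (c : ℂ) :
    frontier (connectedComponentIn (hat Kb) c) ⊆ (hat Kb)ᶜ := by
  intro z hz hzh
  have hzo : IsOpen (connectedComponentIn (hat Kb) z) := (isOpen_hat hK).connectedComponentIn
  obtain ⟨w, hwz, hwc⟩ := mem_closure_iff_nhds.1 hz.1 _ (hzo.mem_nhds (mem_connectedComponentIn hzh))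
  have heq : connectedComponentIn (hat Kb) c = connectedComponentIn (hat Kb) z :=
    (connectedComponentIn_eq hwc).trans (connectedComponentIn_eq hwz).symm
  have : z ∈ interior (connectedComponentIn (hat Kb) c) := by
    rw [((isOpen_hat hK).connectedComponentIn).interior_eq, heq]
    exact mem_connectedComponentIn hzh
  exact hz.2 this

/-! ### The symmetric Riemann map of a symmetric domain -/

/-- **The symmetric Riemann map.** For an open connected conjugation-symmetric `U ⊊ ℂ` all of whose
complementary components are unbounded (so `U` is simply connected, Conway VIII.2.2) and a real point
`x ∈ U`, the Riemann map `f : U → 𝔻` normalised by `f x = 0`, `f' x > 0` commutes with complex conjugation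
(uniqueness of the normalised Riemann map applied to `z ↦ conj f (conj z)`). [folklore] -/
theorem exists_conformalEquiv_map_conj_of_compl {U : Set ℂ} {x : ℝ} (hU : IsOpen U) (hUc : IsConnected U)
    (hU' : U ≠ univ) (hxU : (x : ℂ) ∈ U) (hsymm : ∀ z ∈ U, conj z ∈ U)
    (hcompl : ∀ p ∈ Uᶜ, ¬ IsBounded (connectedComponentIn Uᶜ p)) :
    ∃ f : ConformalEquiv U (ball (0 : ℂ) 1), f x = 0 ∧ ∀ z ∈ U, f (conj z) = conj (f z) := by
  have hsc : IsSimplyConnected U := Complex.isSimplyConnected_of_compl hU hUc hcompl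
  obtain ⟨f, hf0, hre, him⟩ := exists_conformalEquiv_ball_deriv_pos hU hsc hU' hxU
  refine ⟨f, hf0, ?_⟩
  set g := f.conjBall hU hsymm with hg
  have hg0 : g x = 0 := by
    rw [hg, ConformalEquiv.conjBall_apply, Complex.conj_ofReal, hf0, map_zero]
  have hdg : deriv g x = conj (deriv f x) := by
    rw [hg, ConformalEquiv.coe_conjBall, deriv_conj_conj]
    simp
  have hgre : 0 < (deriv g x).re := by rw [hdg, conj_re]; exact hre
  have hgim : (deriv g x).im = 0 := by rw [hdg, conj_im, him, neg_zero]
  have heq : EqOn g f U := ConformalEquiv.eqOn_of_deriv_pos hU hxU f g hf0 hg0 hre him hgre hgim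
  intro z hz
  have h := heq (hsymm z hz)
  rw [hg, ConformalEquiv.conjBall_apply, conj_conj] at h
  exact h.symm

/-- All complementary components of a component `comp Kb x` of the reflected defect are unbounded: each
contains, or is attached to, the connected unbounded set `Kb ∪ conj Kb`. [folklore] -/
theorem not_isBounded_connectedComponentIn_compl_comp (hK : IsClosed Kb) (hKH : Kb ⊆ {z | 0 ≤ z.im})
    (hKc : IsPreconnected Kb) (hunb : ¬ IsBounded Kb) (hreal : ∃ x : ℝ, (x : ℂ) ∈ Kb) (x : ℝ)
    {p : ℂ} (hp : p ∈ (comp Kb x)ᶜ) : ¬ IsBounded (connectedComponentIn (comp Kb x)ᶜ p) := by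
  intro hb
  have hKhat : IsPreconnected (hat Kb)ᶜ := isPreconnected_compl_hat hKH hKc hreal
  have hKunb : ¬ IsBounded (hat Kb)ᶜ := fun h ↦ hunb (h.subset (by
    rw [compl_hat_eq hKH]; exact subset_union_left))
  by_cases hph : p ∈ hat Kb
  · -- `p` lies in another component `C'`; `C' ∪ {z₀} ∪ (Kb ∪ conj Kb)` is connected and unbounded
    set C' : Set ℂ := connectedComponentIn (hat Kb) p with hC'
    have hpC' : p ∈ C' := mem_connectedComponentIn hph
    have hdisj : Disjoint C' (comp Kb x) := by
      rw [Set.disjoint_left]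
      intro z hz hz'
      apply hp
      show p ∈ connectedComponentIn (hat Kb) x
      rw [connectedComponentIn_eq hz', ← connectedComponentIn_eq hz]
      exact hpC'
    have hfrne : (frontier C').Nonempty := by
      by_contra h
      rw [not_nonempty_iff_eq_empty, ← isClopen_iff_frontier_eq_empty, isClopen_iff] at h
      rcases h with h | h
      · rw [h] at hpC'; exact hpC'
      · obtain ⟨y, hy⟩ := hreal
        have : (y : ℂ) ∈ C' := by rw [h]; exact mem_univ _
        exact (mem_hat_iff_of_im_nonneg (hKH hy)).1 (connectedComponentIn_subset _ _ this) hy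
    obtain ⟨z₀, hz₀⟩ := hfrne
    have hz₀K : z₀ ∈ (hat Kb)ᶜ := frontier_connectedComponentIn_subset_compl hK p hz₀
    have hM : IsPreconnected (C' ∪ {z₀} ∪ (hat Kb)ᶜ) := by
      refine IsPreconnected.union z₀ (Or.inr rfl) hz₀K ?_ hKhat
      exact isPreconnected_connectedComponentIn.subset_closure subset_union_left
        (union_subset subset_closure (singleton_subset_iff.2 hz₀.1))
    have hMsub : C' ∪ {z₀} ∪ (hat Kb)ᶜ ⊆ (comp Kb x)ᶜ := by
      rintro z ((hz | rfl) | hz)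
      · exact fun h ↦ Set.disjoint_left.1 hdisj hz h
      · exact fun h ↦ hz₀K (comp_subset x h)
      · exact fun h ↦ hz (comp_subset x h)
    have hsub := hM.subset_connectedComponentIn (Or.inl (Or.inl hpC')) hMsub
    exact hKunb (hb.subset (subset_union_right.trans hsub))
  · have hsub := hKhat.subset_connectedComponentIn hph fun z hz h ↦ hz (comp_subset x h)
    exact hKunb (hb.subset hsub)

/-- A component of the reflected defect is a proper subset of `ℂ` (it misses `Kb ≠ ∅`). [folklore] -/
theorem comp_ne_univ (hKH : Kb ⊆ {z | 0 ≤ z.im}) (hreal : ∃ x : ℝ, (x : ℂ) ∈ Kb) (x : ℝ) :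
    comp Kb x ≠ univ := by
  obtain ⟨y, hy⟩ := hreal
  intro h
  have : (y : ℂ) ∈ comp Kb x := by rw [h]; exact mem_univ _
  exact (mem_hat_iff_of_im_nonneg (hKH hy)).1 (comp_subset x this) hy

/-- **The symmetric Riemann map of a component of the reflected defect** through a real point `x ∈ Â`.
[folklore] -/
theorem exists_conformalEquiv_map_conj (hK : IsClosed Kb) (hKH : Kb ⊆ {z | 0 ≤ z.im})
    (hKc : IsPreconnected Kb) (hunb : ¬ IsBounded Kb) (hreal : ∃ x : ℝ, (x : ℂ) ∈ Kb) {x : ℝ}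
    (hx : (x : ℂ) ∈ hat Kb) :
    ∃ f : ConformalEquiv (comp Kb x) (ball (0 : ℂ) 1), f x = 0 ∧
      ∀ z ∈ comp Kb x, f (conj z) = conj (f z) :=
  exists_conformalEquiv_map_conj_of_compl (isOpen_comp hK x) (isConnected_connectedComponentIn_iff.2 hx)
    (comp_ne_univ hKH hreal x) (mem_connectedComponentIn hx) (fun _ hz ↦ conj_mem_comp hz)
    (fun _ hp ↦ not_isBounded_connectedComponentIn_compl_comp hK hKH hKc hunb hreal x hp)

/-! ### Symmetric charts -/

/-- A **symmetric chart** of a set `U ⊆ ℂ`: a homeomorphism of `U` onto the open unit disc (given with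
its inverse) commuting with complex conjugation and sending `U ∩ ℍ` into the upper half-disc. [folklore] -/
structure SymChart (U : Set ℂ) where
  /-- The chart. -/
  toFun : ℂ → ℂ
  /-- Its inverse on the disc. -/
  invFun : ℂ → ℂ
  /-- `U` goes into the disc. -/
  mapsTo : MapsTo toFun U (ball 0 1)
  /-- The disc goes into `U`. -/
  mapsTo_inv : MapsTo invFun (ball 0 1) U
  /-- Left inverse. -/
  left_inv : ∀ z ∈ U, invFun (toFun z) = z
  /-- Right inverse. -/
  right_inv : ∀ w ∈ ball (0 : ℂ) 1, toFun (invFun w) = w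
  /-- Continuity of the chart. -/
  continuousOn : ContinuousOn toFun U
  /-- Continuity of the inverse. -/
  continuousOn_inv : ContinuousOn invFun (ball 0 1)
  /-- The chart commutes with conjugation. -/
  map_conj : ∀ z ∈ U, toFun (conj z) = conj (toFun z)
  /-- The upper part of `U` goes to the upper half-disc. -/
  im_pos_iff : ∀ z ∈ U, 0 < z.im ↔ 0 < (toFun z).im

/-- A real value of a conjugation-commuting injection comes from a real point. [folklore] -/
theorem im_eq_zero_of_map_conj {U : Set ℂ} {f : ℂ → ℂ} (hinj : InjOn f U)
    (hsymm : ∀ z ∈ U, conj z ∈ U) (hconj : ∀ z ∈ U, f (conj z) = conj (f z)) {z : ℂ} (hz : z ∈ U)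
    (h : (f z).im = 0) : z.im = 0 := by
  have h1 : f (conj z) = f z := by rw [hconj z hz, conj_eq_iff_im.2 h]
  have h2 : conj z = z := hinj (hsymm z hz) hz h1
  exact conj_eq_iff_im.1 h2

/-- **Symmetric charts exist** on every component of the reflected defect through a real point: take the
symmetric Riemann map `f`; the connected set `f⁻¹(upper half-disc)` misses `ℝ`, so lies in `ℍ` or in `-ℍ`,
and accordingly `f` or `-f` is a symmetric chart. [folklore] -/
theorem nonempty_symChart (hK : IsClosed Kb) (hKH : Kb ⊆ {z | 0 ≤ z.im}) (hKc : IsPreconnected Kb)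
    (hunb : ¬ IsBounded Kb) (hreal : ∃ x : ℝ, (x : ℂ) ∈ Kb) {x : ℝ} (hx : (x : ℂ) ∈ hat Kb) :
    Nonempty (SymChart (comp Kb x)) := by
  obtain ⟨f, -, hconj⟩ := exists_conformalEquiv_map_conj hK hKH hKc hunb hreal hx
  have hsymm : ∀ z ∈ comp Kb x, conj z ∈ comp Kb x := fun z hz ↦ conj_mem_comp hz
  have hconj' : ∀ w ∈ ball (0 : ℂ) 1, f.symm (conj w) = conj (f.symm w) := by
    intro w hw
    have hw' : conj w ∈ ball (0 : ℂ) 1 := by rwa [mem_ball_zero_iff, norm_conj, ← mem_ball_zero_iff]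
    have h1 : f (conj (f.symm w)) = conj w := by
      rw [hconj _ (f.symm_mapsTo hw), f.apply_symm_apply hw]
    have := f.symm_apply_apply (hsymm _ (f.symm_mapsTo hw))
    rw [h1] at this
    exact this
  have hreal_iff : ∀ z ∈ comp Kb x, (f z).im = 0 → z.im = 0 := fun z hz h ↦
    im_eq_zero_of_map_conj f.injOn hsymm hconj hz h
  -- the connected set `Q = f⁻¹(upper half-disc)` misses the real axis
  set P : Set ℂ := ball (0 : ℂ) 1 ∩ {w | 0 < w.im} with hP
  have hPc : IsPreconnected P :=
    ((convex_ball (0 : ℂ) 1).inter (convex_halfSpace_im_gt 0)).isPreconnected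
  have hQc : IsPreconnected (f.symm '' P) := hPc.image _ (f.symm.continuousOn.mono inter_subset_left)
  have hQcover : f.symm '' P ⊆ {z : ℂ | 0 < z.im} ∪ {z : ℂ | z.im < 0} := by
    rintro _ ⟨w, hw, rfl⟩
    have hne : (f.symm w).im ≠ 0 := fun h ↦ by
      have h1 : (f (f.symm w)).im = 0 := by
        have := hconj _ (f.symm_mapsTo hw.1)
        rw [conj_eq_iff_im.2 h] at this
        exact conj_eq_iff_im.1 this.symm
      rw [f.apply_symm_apply hw.1] at h1
      exact hw.2.ne' h1
    rcases hne.lt_or_gt with h | h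
    · exact Or.inr h
    · exact Or.inl h
  have hopen₁ : IsOpen {z : ℂ | 0 < z.im} := isOpen_lt continuous_const continuous_im
  have hopen₂ : IsOpen {z : ℂ | z.im < 0} := isOpen_lt continuous_im continuous_const
  have hdis : Disjoint {z : ℂ | 0 < z.im} {z : ℂ | z.im < 0} :=
    Set.disjoint_left.2 fun z (hz : 0 < z.im) (hz' : z.im < 0) ↦ lt_asymm hz hz'
  have hfs : ∀ z ∈ comp Kb x, f.symm (f z) = z := fun z hz ↦ f.symm_apply_apply hz
  have hconjball : ∀ w ∈ ball (0 : ℂ) 1, conj w ∈ ball (0 : ℂ) 1 := fun w hw ↦ by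
    rwa [mem_ball_zero_iff, norm_conj, ← mem_ball_zero_iff]
  rcases hQc.subset_or_subset hopen₁ hopen₂ hdis hQcover with h | h
  · -- `f` itself is a symmetric chart
    have hside : ∀ w ∈ ball (0 : ℂ) 1, 0 < w.im → 0 < (f.symm w).im := fun w hw hw' ↦
      h ⟨w, ⟨hw, hw'⟩, rfl⟩
    refine ⟨{ toFun := f, invFun := f.symm, mapsTo := f.mapsTo, mapsTo_inv := f.symm_mapsTo,
              left_inv := hfs, right_inv := fun w hw ↦ f.apply_symm_apply hw,
              continuousOn := f.continuousOn, continuousOn_inv := f.symm.continuousOn,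
              map_conj := hconj, im_pos_iff := fun z hz ↦ ⟨fun hzim ↦ ?_, fun hpos ↦ ?_⟩ }⟩
    · have hfz : f z ∈ ball (0 : ℂ) 1 := f.mapsTo hz
      have hne : (f z).im ≠ 0 := fun h ↦ hzim.ne' (hreal_iff z hz h)
      by_contra hle
      have hlt : (f z).im < 0 := lt_of_le_of_ne (not_lt.1 hle) hne
      have h1 := hside _ (hconjball _ hfz) (by rw [conj_im]; linarith)
      rw [hconj' _ hfz, hfs z hz, conj_im] at h1
      linarith
    · have h1 := hside _ (f.mapsTo hz) hpos
      rwa [hfs z hz] at h1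
  · -- `-f` is a symmetric chart
    have hside : ∀ w ∈ ball (0 : ℂ) 1, 0 < w.im → (f.symm w).im < 0 := fun w hw hw' ↦
      h ⟨w, ⟨hw, hw'⟩, rfl⟩
    have hnegball : ∀ w ∈ ball (0 : ℂ) 1, -w ∈ ball (0 : ℂ) 1 := fun w hw ↦ by
      rwa [mem_ball_zero_iff, norm_neg, ← mem_ball_zero_iff]
    refine ⟨{ toFun := fun z ↦ -f z, invFun := fun w ↦ f.symm (-w),
              mapsTo := fun z hz ↦ hnegball _ (f.mapsTo hz),
              mapsTo_inv := fun w hw ↦ f.symm_mapsTo (hnegball w hw),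
              left_inv := fun z hz ↦ by
                show f.symm (-(-f z)) = z
                rw [neg_neg]; exact hfs z hz,
              right_inv := fun w hw ↦ by
                show -f (f.symm (-w)) = w
                rw [f.apply_symm_apply (hnegball w hw), neg_neg],
              continuousOn := f.continuousOn.neg,
              continuousOn_inv := f.symm.continuousOn.comp continuousOn_neg
                (fun w hw ↦ hnegball w hw),
              map_conj := fun z hz ↦ by
                show -f (conj z) = conj (-f z)
                rw [map_neg, hconj z hz],
              im_pos_iff := fun z hz ↦ ⟨fun hzim ↦ ?_, fun hpos ↦ ?_⟩ }⟩
    · have hfz : f z ∈ ball (0 : ℂ) 1 := f.mapsTo hz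
      have hne : (f z).im ≠ 0 := fun h ↦ hzim.ne' (hreal_iff z hz h)
      simp only [neg_im, Left.neg_pos_iff]
      by_contra hle
      have hlt : 0 < (f z).im := lt_of_le_of_ne (not_lt.1 hle) hne.symm
      have h1 := hside _ hfz hlt
      rw [hfs z hz] at h1
      linarith
    · have hfz : f z ∈ ball (0 : ℂ) 1 := f.mapsTo hz
      simp only [neg_im, Left.neg_pos_iff] at hpos
      have h1 := hside _ (hconjball _ hfz) (by rw [conj_im]; linarith)
      rw [hconj' _ hfz, hfs z hz, conj_im] at h1
      linarith

/-- **Registered helper stub `stub_squeezeSymRiemann`** (towards `stub_squeezeFamily`, line `birth`): the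
symmetric Riemann map `exists_conformalEquiv_map_conj_of_compl` in closed form. [folklore] -/
theorem stub_squeezeSymRiemann :
    ∀ (U : Set ℂ) (x : ℝ), IsOpen U → IsConnected U → U ≠ Set.univ → (x : ℂ) ∈ U →
      (∀ z ∈ U, (starRingEnd ℂ) z ∈ U) → (∀ p ∈ Uᶜ, ¬ Bornology.IsBounded (connectedComponentIn Uᶜ p)) →
      ∃ f : ConformalEquiv U (Metric.ball 0 1), f x = 0 ∧ ∀ z ∈ U, f ((starRingEnd ℂ) z) = (starRingEnd ℂ) (f z) :=
  fun _ _ hU hUc hU' hxU hsymm hcompl ↦ exists_conformalEquiv_map_conj_of_compl hU hUc hU' hxU hsymm hcompl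

end Summit.CriticalPhenomena.SAWScalingLimit.Theorems.RestrictionOfLimit.Birth

end
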